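import Literature.MathematicalPhysics.QuantumFieldTheory.Balaban1983to89.Node00.Record13NumericsOfThm1C

/-!
# NODE 00 (YM-PLAN Track A) — STAGE 13: THE NUMERICS OF THE C¹ ROUTE — keyed to [15]'s class constants `(B₃, B₃′, a₀, a₁)` and the block size `L`,
# meeting ALSO the two scale-free «C₀ sufficiently large» letters of node00-def-P11's `bgRowAt_of_classBoundsC1` (FILE 7b∕7c) — the third one-def re-pin,
# and the witness `θ₁₅ᶜᶜ¹ = theta13OfThm1CC1` with its faces

Cell `pub-ymgap`, seat `pub-ymgap-node00-def-K0a` (g6), FILE 13a (companions: FILE 13b `Node00/Record13SepBgRowOfClassC1` lifts node00-def-P11's FACT-FREE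
`bgRowAt_of_classBoundsC1` to the Stage-13 parameter per partition-compatible run and proves every numerics face at `θ₁₅ᶜᶜ¹`; FILE 13c
`Node00/Record13SepInhabitedOfClassC1` composes it with the ⁗ socket of FILE 12a).  FILE 11a (`Node00/Record13NumericsOfThm1C`) met the letters of both halves of
row P11 (`0 < cR·ε_m ≤ a₁`, `B₃·cR·ε_m ≤ εreg ≤ a₀`, `B₃·cR·A₀ ≤ (1 − β)·C₀`, `cB > 2(d−1)·L·M`, `B·C·Mr > 2(d−1)·M`, chart reachability `≤ ½`); node00-def-P11's C¹ route
(FILE 7b `Node00/Record12BgRowGaugeC1` ★★ `bgRowAt_of_classBoundsC1`, FILE 7c `Node00/Record12BgRowGaugeC1Letters`) replaces the derivative members `h3I`∕`h3MS` by ONE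
C¹ class clause with its own constant `B₃′` and adds two letters: `Λ(L·M)·cR·A₀ ≤ t_I·C₀` with `t_I < cB` and `Λ(M)·cR·A₀ ≤ t_MS·C₀` with `t_MS < B·C·M_r`, where
`Λ(Y) = 4(B₃ + (d−1)·Y·B₃′) + 16((d−1)·Y)²·B₃²·a₁` — met here by ONE more numerics definition (the profile constant shrinks with `Λ(L)`: LOCATED-L, as `cB` was).
[I] = [Balaban1987RG1], [III] = [Balaban1988Convergent], [IV] = [Balaban1989LargeFieldI], [15] = [Balaban1985Variational].

WHAT THIS FILE PROVIDES.
* §1 THE LETTERS: `lambdaOfThm1CC1 Y B₃ B₃' a₁ := 4·(B₃ + 3·Y·B₃′) + 16·(3·Y)²·B₃²·a₁` (def-P11's `Λ(Y)` at `d − 1 = 3`; `0 ≤ Λ`, monotone in `Y ≥ 0`);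
  `A0OfThm1CC1 L B₃ B₃' a₀ a₁ := A0OfThm1C B₃ a₀ a₁ ∕ (1 + Λ(L))` (`0 < A₀ᶜᶜ¹ ≤ A₀ᶜ`, so `A₀ᶜᶜ¹ ≤ a₁`, `B₃·A₀ᶜᶜ¹ ≤ a₀`, `B₃·A₀ᶜᶜ¹ ≤ 1∕16`, and ★ `Λ(L)·A₀ᶜᶜ¹ ≤ 1∕16`);
  `numerics7OfThm1CC1 L ε₀ B₃ B₃' a₀ a₁` (the family's Stage-7 numerics with `A₀ := A0OfThm1CC1`, `εreg := a₀`); `stage12NumericsOfThm1CC1 L ε₀ B₃ B₃' a₀ a₁`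
  (over FILE 11a's `sect2NumericsOfThm1C L`: `cB = 6·L + 1`, `B = 7`, `C = M_r = 1`, `β = ¼`, `cR = 1`, `lf = lfConstsOfFamily` — `C₀ = 1`, `q₀ = 2`, `κ = 2·10⁴` — UNCHANGED,
  `rfl`) + `rfl` views + `stage12NumericsOfThm1CC1_pos (hε) (hB) (hB') (ha₀) (ha₁)`.
* §2 WINDOW ⇒ LETTERS IN KERNEL at the new numerics: `numerics_thm1CC1_of_inInterval` (def-P11's (hnum)), `mul_A0_nonneg_thm1CC1` ∕ `mul_A0_le_C₀_thm1CC1` ((hBα)'s inputs),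
  `mul_epsOfRecord_thm1CC1_le` (`B₃·cR·ε_m ≤ 1∕16`), ★ `lambda_mul_A0_le_C₀_thm1CC1` (`Λ(Y)·cR·A₀ᶜᶜ¹ ≤ 1·C₀` for `0 ≤ Y ≤ L`: BOTH new letters at `t = 1 < 7 ≤ 6L + 1`),
  `lambda_mul_A0_nonneg_thm1CC1`.
* §3 THE WITNESS `theta13OfThm1CC1 F N ε₀ ε₂₉ B₃ B₃' a₀ a₁ := theta13LiveOfNumerics F N (stage12NumericsOfThm1CC1 F.L ε₀ B₃ B₃' a₀ a₁) ε₂₉ (ζ, Rz, Zt of record)` (a MEMBER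
  of FILE 9's all-numerics family, `rfl`), `rfl` views and faces (`admissible_` under the six signs, `eight_le_L_`, `kp_tree_∕kp_large_∕kp_n10_`, `hasResidualsOfRecord_`,
  `ztUnity_`, `slotsNondegenerate₁₃_…_of_hasResiduals` hypothesis-free by FILE 9 v1.1).

HONEST FRAMING.  Bookkeeping of a re-pinned parameter family + elementary real inequalities; the numerals are displayed choices meeting node00-def-P11's letter
inequalities for ANY values of the class constants `B₃, B₃′ ≥ 0`, `a₀, a₁ > 0` and any block size `L` — not Bałaban's constants; nothing of Bałaban asserted; NOT a
discharge; K0⁗ NOT closed by this file; counts unmoved (typed 28∕28 · discharged 5∕28); one finite 𝕋⁴ programme at fixed ε — NOT continuum ∕ OS ∕ mass gap ∕ Clay.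
No `sorry`, no `axiom`, no `instance`, no `notation`.
-/

noncomputable section

open MeasureTheory
open scoped Matrix.Norms.L2Operator

namespace Literature.MathematicalPhysics.QuantumFieldTheory.Balaban1983to89.Node00

open T4Continuum B14.Eq218Concrete B15DeterminingSets B12RegularSpaces111 B14RegularSpaces234

/-! ## §1. The letter constant of the C¹ route, the profile constant meeting it, and the numerics carrying both -/

section Letters

/-- **node00-def-P11's LETTER CONSTANT OF THE C¹ ROUTE at `d − 1 = 3`**: `Λ(Y) := 4·(B₃ + 3·Y·B₃′) + 16·(3·Y)²·B₃²·a₁` — the coefficient of `cR·ε_j` bounding the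
comb-gauge gradient letter `4(b + (d−1)Y·b′ + 4((d−1)Y)²b²)` with `b = B₃·cR·ε_j`, `b′ = B₃′·cR·ε_j`, `cR·ε_j ≤ a₁` (FILE 7c `letter_le_mul`); `Y = L·M` for the
`O(1)LM`-cubes of [I] (1.12), `Y = M` for the layer cubes of [III] (2.38). [cite: Balaban1988Convergent, (2.28) p.259, (2.38) p.261; Balaban1987RG1, (1.12) p.262 (bookkeeping)] -/
def lambdaOfThm1CC1 (Y B₃ B₃' a₁ : ℝ) : ℝ :=
  4 * (B₃ + 3 * Y * B₃') + 16 * (3 * Y) ^ 2 * B₃ ^ 2 * a₁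

variable {Y Y' B₃ B₃' a₀ a₁ : ℝ}

/-- `0 ≤ Λ(Y)` under the weak signs. [cite: Balaban1988Convergent, (2.28) p.259 (bookkeeping)] -/
theorem lambdaOfThm1CC1_nonneg (hY : 0 ≤ Y) (hB : 0 ≤ B₃) (hB' : 0 ≤ B₃') (ha₁ : 0 ≤ a₁) : 0 ≤ lambdaOfThm1CC1 Y B₃ B₃' a₁ := by
  unfold lambdaOfThm1CC1
  positivity

/-- `Λ` is monotone in `Y ≥ 0` (so the `O(1)LM`-cube letter dominates the layer-cube one, `M ≤ L·M`). [cite: Balaban1988Convergent, (2.28) p.259, (2.38) p.261 (bookkeeping)] -/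
theorem lambdaOfThm1CC1_mono (hY : 0 ≤ Y) (hYY : Y ≤ Y') (hB' : 0 ≤ B₃') (ha₁ : 0 ≤ a₁) :
    lambdaOfThm1CC1 Y B₃ B₃' a₁ ≤ lambdaOfThm1CC1 Y' B₃ B₃' a₁ := by
  unfold lambdaOfThm1CC1
  have h1 : Y * B₃' ≤ Y' * B₃' := mul_le_mul_of_nonneg_right hYY hB'
  have h2 : (3 * Y) ^ 2 ≤ (3 * Y') ^ 2 := by gcongr
  have h3 : (3 * Y) ^ 2 * B₃ ^ 2 * a₁ ≤ (3 * Y') ^ 2 * B₃ ^ 2 * a₁ :=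
    mul_le_mul_of_nonneg_right (mul_le_mul_of_nonneg_right h2 (sq_nonneg _)) ha₁
  nlinarith

/-- The letter constant IS node00-def-P11's expression at `D = ((4 − 1 : ℕ) : ℝ)` (the `d = 4` of the record's `Setup.Params`). [cite: Balaban1988Convergent, (2.28) p.259 (bookkeeping)] -/
theorem lambdaOfThm1CC1_eq (Y B₃ B₃' a₁ : ℝ) :
    4 * (B₃ + ((4 - 1 : ℕ) : ℝ) * Y * B₃') + 16 * (((4 - 1 : ℕ) : ℝ) * Y) ^ 2 * B₃ ^ 2 * a₁ = lambdaOfThm1CC1 Y B₃ B₃' a₁ := by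
  unfold lambdaOfThm1CC1
  norm_num

/-- **THE PROFILE CONSTANT OF THE C¹ ROUTE**: `A₀ᶜᶜ¹(L; B₃, B₃′, a₀, a₁) := A₀ᶜ(B₃, a₀, a₁) ∕ (1 + Λ(L))` — the extra factor makes both «C₀ sufficiently large» letters of
node00-def-P11's FILE 7c hold with `t = 1` (`Λ(L·M)·cR·A₀ᶜᶜ¹ ≤ A₀ᶜ ≤ 1∕16 ≤ C₀ = 1` at `M = cR = 1`), while every letter met by `A₀ᶜ` survives (`A₀ᶜᶜ¹ ≤ A₀ᶜ`).
A displayed choice, not Bałaban's constant. [cite: Balaban1988Convergent, (2.4) p.255, (2.28) p.259; Balaban1985Variational, Thm 1 (7)–(10) p.279 (bookkeeping witness)] -/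
def A0OfThm1CC1 (L : ℕ) (B₃ B₃' a₀ a₁ : ℝ) : ℝ :=
  A0OfThm1C B₃ a₀ a₁ / (1 + lambdaOfThm1CC1 L B₃ B₃' a₁)

variable {L : ℕ}

/-- `0 < 1 + Λ(L)`. [cite: Balaban1988Convergent, (2.28) p.259 (bookkeeping)] -/
theorem one_add_lambdaOfThm1CC1_pos (hB : 0 ≤ B₃) (hB' : 0 ≤ B₃') (ha₁ : 0 ≤ a₁) : 0 < 1 + lambdaOfThm1CC1 L B₃ B₃' a₁ := by
  have := lambdaOfThm1CC1_nonneg (Y := (L : ℝ)) (Nat.cast_nonneg L) hB hB' ha₁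
  linarith

/-- `0 < A₀ᶜᶜ¹` under print's signs. [cite: Balaban1988Convergent, (2.4) p.255 (bookkeeping)] -/
theorem A0OfThm1CC1_pos (hB : 0 ≤ B₃) (hB' : 0 ≤ B₃') (ha₀ : 0 < a₀) (ha₁ : 0 < a₁) : 0 < A0OfThm1CC1 L B₃ B₃' a₀ a₁ :=
  div_pos (A0OfThm1C_pos hB ha₀ ha₁) (one_add_lambdaOfThm1CC1_pos hB hB' ha₁.le)

/-- `0 ≤ A₀ᶜᶜ¹` under the weak signs. [cite: Balaban1988Convergent, (2.4) p.255 (bookkeeping)] -/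
theorem A0OfThm1CC1_nonneg (hB : 0 ≤ B₃) (hB' : 0 ≤ B₃') (ha₀ : 0 ≤ a₀) (ha₁ : 0 ≤ a₁) : 0 ≤ A0OfThm1CC1 L B₃ B₃' a₀ a₁ :=
  div_nonneg (A0OfThm1C_nonneg hB ha₀ ha₁) (one_add_lambdaOfThm1CC1_pos hB hB' ha₁).le

/-- `A₀ᶜᶜ¹ ≤ A₀ᶜ`. [cite: Balaban1988Convergent, (2.4) p.255 (bookkeeping)] -/
theorem A0OfThm1CC1_le (hB : 0 ≤ B₃) (hB' : 0 ≤ B₃') (ha₀ : 0 ≤ a₀) (ha₁ : 0 ≤ a₁) : A0OfThm1CC1 L B₃ B₃' a₀ a₁ ≤ A0OfThm1C B₃ a₀ a₁ :=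
  div_le_self (A0OfThm1C_nonneg hB ha₀ ha₁) (by have := lambdaOfThm1CC1_nonneg (Y := (L : ℝ)) (Nat.cast_nonneg L) hB hB' ha₁; linarith)

/-- `A₀ᶜᶜ¹ ≤ a₁`. [cite: Balaban1985Variational, Thm 1 (7) p.279 (bookkeeping)] -/
theorem A0OfThm1CC1_le_a₁ (hB : 0 ≤ B₃) (hB' : 0 ≤ B₃') (ha₀ : 0 ≤ a₀) (ha₁ : 0 ≤ a₁) : A0OfThm1CC1 L B₃ B₃' a₀ a₁ ≤ a₁ :=
  (A0OfThm1CC1_le hB hB' ha₀ ha₁).trans (A0OfThm1C_le_a₁ hB ha₀ ha₁)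

/-- `B₃·A₀ᶜᶜ¹ ≤ a₀`. [cite: Balaban1985Variational, Thm 1 (8) p.279 (bookkeeping)] -/
theorem mul_A0OfThm1CC1_le_a₀ (hB : 0 ≤ B₃) (hB' : 0 ≤ B₃') (ha₀ : 0 ≤ a₀) (ha₁ : 0 ≤ a₁) : B₃ * A0OfThm1CC1 L B₃ B₃' a₀ a₁ ≤ a₀ :=
  (mul_le_mul_of_nonneg_left (A0OfThm1CC1_le hB hB' ha₀ ha₁) hB).trans (mul_A0OfThm1C_le_a₀ hB ha₀ ha₁)

/-- `B₃·A₀ᶜᶜ¹ ≤ 1∕16`. [cite: Balaban1988Convergent, (2.28) p.259, p.256 (bookkeeping)] -/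
theorem mul_A0OfThm1CC1_le (hB : 0 ≤ B₃) (hB' : 0 ≤ B₃') (ha₀ : 0 ≤ a₀) (ha₁ : 0 ≤ a₁) : B₃ * A0OfThm1CC1 L B₃ B₃' a₀ a₁ ≤ 1 / 16 :=
  (mul_le_mul_of_nonneg_left (A0OfThm1CC1_le hB hB' ha₀ ha₁) hB).trans (mul_A0OfThm1C_le hB)

/-- `A₀ᶜ ≤ 1∕16` (`min a₁ (min a₀ ½) ≤ ½`, `1 + B₃ ≥ 1`, `∕8`). [cite: Balaban1988Convergent, (2.4) p.255 (bookkeeping)] -/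
theorem A0OfThm1C_le_sixteenth (hB : 0 ≤ B₃) : A0OfThm1C B₃ a₀ a₁ ≤ 1 / 16 := by
  unfold A0OfThm1C A0OfThm1
  have hm : min a₁ (min a₀ (1 / 2)) ≤ 1 / 2 := (min_le_right _ _).trans (min_le_right _ _)
  have h1 : (1 : ℝ) ≤ 1 + B₃ := by linarith
  have h2 : min a₁ (min a₀ (1 / 2)) / (1 + B₃) ≤ 1 / 2 := by
    rw [div_le_iff₀ (by linarith)]
    nlinarith
  linarith

/-- **★ THE NEW LETTER**: `Λ(Y)·A₀ᶜᶜ¹ ≤ 1∕16` for `0 ≤ Y ≤ L` (`Λ(Y) ≤ Λ(L)`, `Λ(L)∕(1 + Λ(L)) ≤ 1`, `A₀ᶜ ≤ 1∕16`). [cite: Balaban1988Convergent, (2.28) p.259, (2.38) p.261; Balaban1987RG1, (1.12) p.262 (bookkeeping)] -/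
theorem lambda_mul_A0OfThm1CC1_le (hY : 0 ≤ Y) (hYL : Y ≤ L) (hB : 0 ≤ B₃) (hB' : 0 ≤ B₃') (ha₀ : 0 ≤ a₀) (ha₁ : 0 ≤ a₁) :
    lambdaOfThm1CC1 Y B₃ B₃' a₁ * A0OfThm1CC1 L B₃ B₃' a₀ a₁ ≤ 1 / 16 := by
  have hΛY := lambdaOfThm1CC1_mono (B₃ := B₃) hY hYL hB' ha₁
  have hΛ0 : 0 ≤ lambdaOfThm1CC1 Y B₃ B₃' a₁ := lambdaOfThm1CC1_nonneg hY hB hB' ha₁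
  have hA0 : 0 ≤ A0OfThm1CC1 L B₃ B₃' a₀ a₁ := A0OfThm1CC1_nonneg hB hB' ha₀ ha₁
  have hAC : 0 ≤ A0OfThm1C B₃ a₀ a₁ := A0OfThm1C_nonneg hB ha₀ ha₁
  have h16 := A0OfThm1C_le_sixteenth (a₀ := a₀) (a₁ := a₁) hB
  have hpos := one_add_lambdaOfThm1CC1_pos (L := L) hB hB' ha₁
  calc lambdaOfThm1CC1 Y B₃ B₃' a₁ * A0OfThm1CC1 L B₃ B₃' a₀ a₁
      ≤ lambdaOfThm1CC1 L B₃ B₃' a₁ * A0OfThm1CC1 L B₃ B₃' a₀ a₁ := mul_le_mul_of_nonneg_right hΛY hA0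
    _ = (lambdaOfThm1CC1 L B₃ B₃' a₁ / (1 + lambdaOfThm1CC1 L B₃ B₃' a₁)) * A0OfThm1C B₃ a₀ a₁ := by
        unfold A0OfThm1CC1; ring
    _ ≤ 1 * A0OfThm1C B₃ a₀ a₁ := by
        refine mul_le_mul_of_nonneg_right ?_ hAC
        rw [div_le_one hpos]
        linarith
    _ ≤ 1 / 16 := by linarith

/-- **def-R's Stage-7 numerics OF THE C¹ ROUTE**: the family's with `A₀ := A0OfThm1CC1 L B₃ B₃' a₀ a₁`, `εreg := a₀`. [cite: Balaban1988Convergent, (2.4) p.255, (2.12) p.256; Balaban1985Variational, Thm 1 p.279 (bookkeeping witness)] -/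
def numerics7OfThm1CC1 (L : ℕ) (ε₀ B₃ B₃' a₀ a₁ : ℝ) : Stage7Numerics :=
  { numerics7OfFamily ε₀ with A₀ := A0OfThm1CC1 L B₃ B₃' a₀ a₁, εreg := a₀ }

variable (L) (ε₀ : ℝ) (B₃ B₃' a₀ a₁)

/-- Its (1.2) letter IS the argument (`rfl`). [cite: Balaban1987RG1, (1.2) p.260 (bookkeeping)] -/
theorem numerics7OfThm1CC1_ε₀ : (numerics7OfThm1CC1 L ε₀ B₃ B₃' a₀ a₁).ε₀ = ε₀ := rfl

/-- Its profile constant IS `A₀ᶜᶜ¹` (`rfl`). [cite: Balaban1988Convergent, (2.4) p.255 (bookkeeping)] -/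
theorem numerics7OfThm1CC1_A₀ : (numerics7OfThm1CC1 L ε₀ B₃ B₃' a₀ a₁).A₀ = A0OfThm1CC1 L B₃ B₃' a₀ a₁ := rfl

/-- Its regularity threshold IS `a₀` (`rfl`). [cite: Balaban1985Variational, Thm 1 p.279 (bookkeeping)] -/
theorem numerics7OfThm1CC1_εreg : (numerics7OfThm1CC1 L ε₀ B₃ B₃' a₀ a₁).εreg = a₀ := rfl

/-- Its profile exponent is the family's `p₀ = 1` (`rfl`). [cite: Balaban1988Convergent, (2.4) p.255 (bookkeeping)] -/
theorem numerics7OfThm1CC1_p₀ : (numerics7OfThm1CC1 L ε₀ B₃ B₃' a₀ a₁).p₀ = 1 := rfl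

/-- Its (2.5) exponent is the family's `r = 1` (`rfl`). [cite: Balaban1988Convergent, (2.5) p.255 (bookkeeping)] -/
theorem numerics7OfThm1CC1_r : (numerics7OfThm1CC1 L ε₀ B₃ B₃' a₀ a₁).r = 1 := rfl

/-- **THE STAGE-12 NUMERICS OF THE C¹ ROUTE**: the family's over `numerics7OfThm1CC1 L ε₀ B₃ B₃' a₀ a₁` and FILE 11a's `sect2NumericsOfThm1C L` (`cB = 6L + 1`, `B = 7`).
[cite: Balaban1988Convergent, (2.4) p.255, (2.10) p.256, (2.28) p.259, (2.38) p.261; Balaban1987RG1, (0.21) p.256, (1.12) p.262 (bookkeeping witness)] -/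
def stage12NumericsOfThm1CC1 (L : ℕ) (ε₀ B₃ B₃' a₀ a₁ : ℝ) : Stage12Numerics :=
  { stage12NumericsOfFamily ε₀ with ν := numerics7OfThm1CC1 L ε₀ B₃ B₃' a₀ a₁, s2 := sect2NumericsOfThm1C L }

/-- Its Stage-7 part (`rfl`). [cite: Balaban1988Convergent, (2.4) p.255 (bookkeeping)] -/
theorem stage12NumericsOfThm1CC1_ν : (stage12NumericsOfThm1CC1 L ε₀ B₃ B₃' a₀ a₁).ν = numerics7OfThm1CC1 L ε₀ B₃ B₃' a₀ a₁ := rfl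

/-- Its §2 numerics ARE FILE 11a's (`rfl`). [cite: Balaban1988Convergent, (2.28) p.259 (bookkeeping)] -/
theorem stage12NumericsOfThm1CC1_s2 : (stage12NumericsOfThm1CC1 L ε₀ B₃ B₃' a₀ a₁).s2 = sect2NumericsOfThm1C L := rfl

/-- Its window constant is the family's `γ = ½` (`rfl`). [cite: Balaban1987RG1, Thm 1 p.255 (bookkeeping)] -/
theorem stage12NumericsOfThm1CC1_γ : (stage12NumericsOfThm1CC1 L ε₀ B₃ B₃' a₀ a₁).γ = 1 / 2 := rfl

/-- Its located regularity constant is the family's `cR = 1` (`rfl`). [cite: Balaban1988Convergent, (2.10) p.256 (bookkeeping)] -/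
theorem stage12NumericsOfThm1CC1_cR : (stage12NumericsOfThm1CC1 L ε₀ B₃ B₃' a₀ a₁).s2.cR = 1 := rfl

/-- Its (2.34) constant is the family's `β = ¼` (`rfl`). [cite: Balaban1988Convergent, (2.34) p.261 (bookkeeping)] -/
theorem stage12NumericsOfThm1CC1_βc : (stage12NumericsOfThm1CC1 L ε₀ B₃ B₃' a₀ a₁).s2.βc = 1 / 4 := rfl

/-- Its term constants ARE the family's (`rfl`). [cite: Balaban1988Convergent, (2.28) p.259 (bookkeeping)] -/
theorem stage12NumericsOfThm1CC1_lf : (stage12NumericsOfThm1CC1 L ε₀ B₃ B₃' a₀ a₁).s2.lf = lfConstsOfFamily := rfl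

/-- Its tower numerics ARE the record's (`rfl`). [cite: Balaban1989LargeFieldI, (2.1) p.182 (bookkeeping)] -/
theorem stage12NumericsOfThm1CC1_τ9 : (stage12NumericsOfThm1CC1 L ε₀ B₃ B₃' a₀ a₁).τ9 = towerNumericsOfRecord₁₂ := rfl

/-- Its (1.16) constant is the family's `A₁ = 1` (`rfl`). [cite: Balaban1987RG1, (1.16) p.262 (bookkeeping)] -/
theorem stage12NumericsOfThm1CC1_A₁ : (stage12NumericsOfThm1CC1 L ε₀ B₃ B₃' a₀ a₁).A₁ = 1 := rfl

variable {L ε₀ B₃ B₃' a₀ a₁}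

/-- **THE NUMERICS MEET EVERY SIGN WINDOW** (`Stage12Numerics.Pos`) under `0 < ε₀`, `0 ≤ B₃`, `0 ≤ B₃′`, `0 < a₀`, `0 < a₁`. [cite: Balaban1988Convergent, (2.4) p.255, (2.10) p.256, (2.28) p.259, (2.34)–(2.39) p.261; Balaban1987RG1, (0.21) p.256; Balaban1985Variational, Thm 1 p.279 (bookkeeping)] -/
theorem stage12NumericsOfThm1CC1_pos (hε : 0 < ε₀) (hB : 0 ≤ B₃) (hB' : 0 ≤ B₃') (ha₀ : 0 < a₀) (ha₁ : 0 < a₁) :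
    (stage12NumericsOfThm1CC1 L ε₀ B₃ B₃' a₀ a₁).Pos := by
  refine ⟨⟨hε, ha₀, A0OfThm1CC1_pos hB hB' ha₀ ha₁, ?_, ?_⟩, ?_, ⟨?_, ?_⟩, ?_, ?_, sect2NumericsOfThm1C_pos L, ?_, ?_, ?_⟩ <;>
    norm_num [stage12NumericsOfThm1CC1, numerics7OfThm1CC1, sect2NumericsOfThm1C, stage12NumericsOfFamily, stage12NumericsOfRecord, numerics7OfFamily,
      numerics7OfRecord₁₂, towerNumericsOfRecord₁₂, sect2NumericsOfFamily, sect2NumericsOfRecord₁₂, lfConstsOfFamily, lfConstsOfRecord₁₂]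

end Letters

/-! ## §2. Window ⇒ the letter inequalities of the C¹ route, in kernel -/

section Window

variable {L : ℕ} {ε₀ B₃ B₃' a₀ a₁ : ℝ}

/-- **def-P11's (hnum) AT THE NEW NUMERICS, along every history in a window `]0, γ]`, `γ < 1`**: `0 < cR·ε_m`, `cR·ε_m ≤ a₁`, `B₃·cR·ε_m ≤ εreg` for `m ≤ n`.
[cite: Balaban1988Convergent, (2.4) p.255, (2.10) p.256, (2.12) p.256; Balaban1985Variational, Thm 1 (7)–(8) p.279] -/
theorem numerics_thm1CC1_of_inInterval (hB : 0 ≤ B₃) (hB' : 0 ≤ B₃') (ha₀ : 0 < a₀) (ha₁ : 0 < a₁) {γ : ℝ} (hγ : γ < 1) {g : ℕ → ℝ} {n : ℕ}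
    (hw : Step.InInterval γ n g) : ∀ m, m ≤ n →
      0 < (stage12NumericsOfThm1CC1 L ε₀ B₃ B₃' a₀ a₁).s2.cR * epsOfRecord (stage12NumericsOfThm1CC1 L ε₀ B₃ B₃' a₀ a₁).ν g m ∧
      (stage12NumericsOfThm1CC1 L ε₀ B₃ B₃' a₀ a₁).s2.cR * epsOfRecord (stage12NumericsOfThm1CC1 L ε₀ B₃ B₃' a₀ a₁).ν g m ≤ a₁ ∧
      B₃ * ((stage12NumericsOfThm1CC1 L ε₀ B₃ B₃' a₀ a₁).s2.cR * epsOfRecord (stage12NumericsOfThm1CC1 L ε₀ B₃ B₃' a₀ a₁).ν g m) ≤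
        (stage12NumericsOfThm1CC1 L ε₀ B₃ B₃' a₀ a₁).ν.εreg := by
  intro m hm
  rw [stage12NumericsOfThm1CC1_cR, one_mul, stage12NumericsOfThm1CC1_ν, numerics7OfThm1CC1_εreg]
  have hA : 0 < (numerics7OfThm1CC1 L ε₀ B₃ B₃' a₀ a₁).A₀ := A0OfThm1CC1_pos hB hB' ha₀ ha₁
  have hle : epsOfRecord (numerics7OfThm1CC1 L ε₀ B₃ B₃' a₀ a₁) g m ≤ A0OfThm1CC1 L B₃ B₃' a₀ a₁ :=
    epsOfRecord_le_A₀_of_p₀_eq_one _ rfl hA.le (hw m hm).1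
  exact ⟨epsOfRecord_pos _ hA (hw m hm).1 ((hw m hm).2.trans_lt hγ), hle.trans (A0OfThm1CC1_le_a₁ hB hB' ha₀.le ha₁.le),
    (mul_le_mul_of_nonneg_left hle hB).trans (mul_A0OfThm1CC1_le_a₀ hB hB' ha₀.le ha₁.le)⟩

/-- **THE C⁰ CLASS BOUND IS AT MOST `1∕16`** along every history in a window `]0, γ]`: `B₃·(cR·ε_m) ≤ B₃·A₀ᶜᶜ¹ ≤ 1∕16`. [cite: Balaban1988Convergent, (2.4) p.255, p.256 (bookkeeping)] -/
theorem mul_epsOfRecord_thm1CC1_le (hB : 0 ≤ B₃) (hB' : 0 ≤ B₃') (ha₀ : 0 < a₀) (ha₁ : 0 < a₁) {γ : ℝ} {g : ℕ → ℝ} {n : ℕ}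
    (hw : Step.InInterval γ n g) {m : ℕ} (hm : m ≤ n) :
    B₃ * ((stage12NumericsOfThm1CC1 L ε₀ B₃ B₃' a₀ a₁).s2.cR * epsOfRecord (stage12NumericsOfThm1CC1 L ε₀ B₃ B₃' a₀ a₁).ν g m) ≤ 1 / 16 := by
  rw [stage12NumericsOfThm1CC1_cR, one_mul, stage12NumericsOfThm1CC1_ν]
  have hA : 0 < (numerics7OfThm1CC1 L ε₀ B₃ B₃' a₀ a₁).A₀ := A0OfThm1CC1_pos hB hB' ha₀ ha₁
  have hle : epsOfRecord (numerics7OfThm1CC1 L ε₀ B₃ B₃' a₀ a₁) g m ≤ A0OfThm1CC1 L B₃ B₃' a₀ a₁ :=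
    epsOfRecord_le_A₀_of_p₀_eq_one _ rfl hA.le (hw m hm).1
  exact (mul_le_mul_of_nonneg_left hle hB).trans (mul_A0OfThm1CC1_le hB hB' ha₀.le ha₁.le)

/-- The «C₀ sufficiently large» inequality of (2.34) at the new numerics: `B₃·cR·A₀ᶜᶜ¹ ≤ (1 − β)·C₀` (`≤ 1∕16 ≤ ¾`). [cite: Balaban1988Convergent, (2.28) p.259, (2.34) p.261] -/
theorem mul_A0_le_C₀_thm1CC1 (hB : 0 ≤ B₃) (hB' : 0 ≤ B₃') (ha₀ : 0 ≤ a₀) (ha₁ : 0 ≤ a₁) :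
    B₃ * (stage12NumericsOfThm1CC1 L ε₀ B₃ B₃' a₀ a₁).s2.cR * (stage12NumericsOfThm1CC1 L ε₀ B₃ B₃' a₀ a₁).ν.A₀ ≤
      (1 - (stage12NumericsOfThm1CC1 L ε₀ B₃ B₃' a₀ a₁).s2.βc) * (stage12NumericsOfThm1CC1 L ε₀ B₃ B₃' a₀ a₁).s2.lf.C₀ := by
  rw [stage12NumericsOfThm1CC1_cR, mul_one, stage12NumericsOfThm1CC1_ν, numerics7OfThm1CC1_A₀, stage12NumericsOfThm1CC1_βc, stage12NumericsOfThm1CC1_lf]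
  have h := mul_A0OfThm1CC1_le (L := L) hB hB' ha₀ ha₁
  norm_num [lfConstsOfFamily, lfConstsOfRecord₁₂]
  linarith

/-- … and its sign `0 ≤ B₃·cR·A₀ᶜᶜ¹`. [cite: Balaban1988Convergent, (2.28) p.259 (bookkeeping)] -/
theorem mul_A0_nonneg_thm1CC1 (hB : 0 ≤ B₃) (hB' : 0 ≤ B₃') (ha₀ : 0 ≤ a₀) (ha₁ : 0 ≤ a₁) :
    0 ≤ B₃ * (stage12NumericsOfThm1CC1 L ε₀ B₃ B₃' a₀ a₁).s2.cR * (stage12NumericsOfThm1CC1 L ε₀ B₃ B₃' a₀ a₁).ν.A₀ := by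
  rw [stage12NumericsOfThm1CC1_cR, mul_one, stage12NumericsOfThm1CC1_ν, numerics7OfThm1CC1_A₀]
  exact mul_nonneg hB (A0OfThm1CC1_nonneg hB hB' ha₀ ha₁)

/-- **★ BOTH «C₀ sufficiently large» LETTERS OF THE C¹ ROUTE at the new numerics**: `Λ(Y)·cR·A₀ᶜᶜ¹ ≤ 1·C₀` for every `0 ≤ Y ≤ L` (`Y = L·M = L` and `Y = M = 1`;
`≤ 1∕16 ≤ 1 = C₀`), i.e. node00-def-P11's `hΛI`∕`hΛMS` with `t_I = t_MS = 1`. [cite: Balaban1988Convergent, (2.28) p.259, (2.38) p.261; Balaban1987RG1, (1.12) p.262] -/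
theorem lambda_mul_A0_le_C₀_thm1CC1 {Y : ℝ} (hY : 0 ≤ Y) (hYL : Y ≤ L) (hB : 0 ≤ B₃) (hB' : 0 ≤ B₃') (ha₀ : 0 ≤ a₀) (ha₁ : 0 ≤ a₁) :
    lambdaOfThm1CC1 Y B₃ B₃' a₁ * (stage12NumericsOfThm1CC1 L ε₀ B₃ B₃' a₀ a₁).s2.cR * (stage12NumericsOfThm1CC1 L ε₀ B₃ B₃' a₀ a₁).ν.A₀ ≤
      1 * (stage12NumericsOfThm1CC1 L ε₀ B₃ B₃' a₀ a₁).s2.lf.C₀ := by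
  rw [stage12NumericsOfThm1CC1_cR, mul_one, stage12NumericsOfThm1CC1_ν, numerics7OfThm1CC1_A₀, stage12NumericsOfThm1CC1_lf]
  have h := lambda_mul_A0OfThm1CC1_le hY hYL hB hB' ha₀ ha₁
  norm_num [lfConstsOfFamily, lfConstsOfRecord₁₂]
  linarith

/-- … and their sign `0 ≤ Λ(Y)·cR·A₀ᶜᶜ¹` for `0 ≤ Y`. [cite: Balaban1988Convergent, (2.28) p.259 (bookkeeping)] -/
theorem lambda_mul_A0_nonneg_thm1CC1 {Y : ℝ} (hY : 0 ≤ Y) (hB : 0 ≤ B₃) (hB' : 0 ≤ B₃') (ha₀ : 0 ≤ a₀) (ha₁ : 0 ≤ a₁) :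
    0 ≤ lambdaOfThm1CC1 Y B₃ B₃' a₁ * (stage12NumericsOfThm1CC1 L ε₀ B₃ B₃' a₀ a₁).s2.cR * (stage12NumericsOfThm1CC1 L ε₀ B₃ B₃' a₀ a₁).ν.A₀ := by
  rw [stage12NumericsOfThm1CC1_cR, mul_one, stage12NumericsOfThm1CC1_ν, numerics7OfThm1CC1_A₀]
  exact mul_nonneg (lambdaOfThm1CC1_nonneg hY hB hB' ha₁) (A0OfThm1CC1_nonneg hB hB' ha₀ ha₁)

end Window

/-! ## §3. ★★ THE WITNESS OF THE C¹ ROUTE `θ₁₅ᶜᶜ¹ = theta13OfThm1CC1 F N ε₀ ε₂₉ B₃ B₃' a₀ a₁` and its faces -/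

section Witness

variable (F : T4Family) (N : ℕ) [NeZero N] (ε₀ ε₂₉ B₃ B₃' a₀ a₁ : ℝ)

/-- **THE STAGE-13 WITNESS OF THE C¹ ROUTE** `θ₁₅ᶜᶜ¹(ε₀, ε₂₉; B₃, B₃′, a₀, a₁)`: the all-numerics live witness family (FILE 9 §3) AT `stage12NumericsOfThm1CC1 F.L ε₀ B₃ B₃' a₀ a₁`,
with K0b's residuals of record — the re-pin at which EVERY letter inequality of node00-def-P11's `bgRowAt_of_classBoundsC1` is a theorem. [cite: Balaban1989LargeFieldI, (0.3) p.176 and p.177; Balaban1988Convergent, (2.4) p.255, (2.10) p.256, (2.28) p.259, (2.38) p.261; Balaban1987RG1, (1.12) p.262; Balaban1985Variational, Thm 1 p.279 (bookkeeping witness)] -/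
def theta13OfThm1CC1 : Stage13Params F N :=
  theta13LiveOfNumerics F N (stage12NumericsOfThm1CC1 F.L ε₀ B₃ B₃' a₀ a₁) ε₂₉
    (zeta316OfRecord F N (stage12NumericsOfThm1CC1 F.L ε₀ B₃ B₃' a₀ a₁).ν (stage12NumericsOfThm1CC1 F.L ε₀ B₃ B₃' a₀ a₁).τ9.M
      (stage12NumericsOfThm1CC1 F.L ε₀ B₃ B₃' a₀ a₁).A₁)
    (RzOfRecord F N) (ZtOfRecord F N)

/-- Unfolding: `θ₁₅ᶜᶜ¹` IS the member of the all-numerics family (`rfl`). [cite: Balaban1989LargeFieldI, (0.3) p.176 (bookkeeping)] -/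
theorem theta13OfThm1CC1_eq :
    theta13OfThm1CC1 F N ε₀ ε₂₉ B₃ B₃' a₀ a₁ =
      theta13LiveOfNumerics F N (stage12NumericsOfThm1CC1 F.L ε₀ B₃ B₃' a₀ a₁) ε₂₉
        (zeta316OfRecord F N (stage12NumericsOfThm1CC1 F.L ε₀ B₃ B₃' a₀ a₁).ν (stage12NumericsOfThm1CC1 F.L ε₀ B₃ B₃' a₀ a₁).τ9.M
          (stage12NumericsOfThm1CC1 F.L ε₀ B₃ B₃' a₀ a₁).A₁)
        (RzOfRecord F N) (ZtOfRecord F N) := rfl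

/-- `θ₁₅ᶜᶜ¹.ν = numerics7OfThm1CC1 F.L ε₀ B₃ B₃' a₀ a₁` (`rfl`). [cite: Balaban1988Convergent, (2.4) p.255 (bookkeeping)] -/
theorem theta13OfThm1CC1_ν : (theta13OfThm1CC1 F N ε₀ ε₂₉ B₃ B₃' a₀ a₁).ν = numerics7OfThm1CC1 F.L ε₀ B₃ B₃' a₀ a₁ := rfl

/-- `θ₁₅ᶜᶜ¹.ν.εreg = a₀` (`rfl`). [cite: Balaban1985Variational, Thm 1 p.279 (bookkeeping)] -/
theorem theta13OfThm1CC1_εreg : (theta13OfThm1CC1 F N ε₀ ε₂₉ B₃ B₃' a₀ a₁).ν.εreg = a₀ := rfl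

/-- `θ₁₅ᶜᶜ¹.ν.A₀ = A₀ᶜᶜ¹(F.L; B₃, B₃′, a₀, a₁)` (`rfl`). [cite: Balaban1988Convergent, (2.4) p.255 (bookkeeping)] -/
theorem theta13OfThm1CC1_A₀ : (theta13OfThm1CC1 F N ε₀ ε₂₉ B₃ B₃' a₀ a₁).ν.A₀ = A0OfThm1CC1 F.L B₃ B₃' a₀ a₁ := rfl

/-- `θ₁₅ᶜᶜ¹.ν.p₀ = 1` (`rfl`). [cite: Balaban1988Convergent, (2.4) p.255 (bookkeeping)] -/
theorem theta13OfThm1CC1_p₀ : (theta13OfThm1CC1 F N ε₀ ε₂₉ B₃ B₃' a₀ a₁).ν.p₀ = 1 := rfl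

/-- `θ₁₅ᶜᶜ¹.ν.r = 1` (`rfl`). [cite: Balaban1988Convergent, (2.5) p.255 (bookkeeping)] -/
theorem theta13OfThm1CC1_r : (theta13OfThm1CC1 F N ε₀ ε₂₉ B₃ B₃' a₀ a₁).ν.r = 1 := rfl

/-- `θ₁₅ᶜᶜ¹.ν.M₁ = 1` (`rfl`) — the separation width of [6] (1.3)–(1.6) at the witness. [cite: Balaban1985RegularSpaces, (1.3)–(1.6) p.77; Balaban1988Convergent, (2.13) p.256 (bookkeeping)] -/
theorem theta13OfThm1CC1_M₁ : (theta13OfThm1CC1 F N ε₀ ε₂₉ B₃ B₃' a₀ a₁).ν.M₁ = 1 := rfl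

/-- `θ₁₅ᶜᶜ¹.ν.ε₀ = ε₀` (`rfl`). [cite: Balaban1987RG1, (1.2) p.260 (bookkeeping)] -/
theorem theta13OfThm1CC1_ε₀ : (theta13OfThm1CC1 F N ε₀ ε₂₉ B₃ B₃' a₀ a₁).ν.ε₀ = ε₀ := rfl

/-- `θ₁₅ᶜᶜ¹.ε₂₉ = ε₂₉` (`rfl`). [cite: Balaban1987RG1, (2.9) p.266 (bookkeeping)] -/
theorem theta13OfThm1CC1_ε₂₉ : (theta13OfThm1CC1 F N ε₀ ε₂₉ B₃ B₃' a₀ a₁).ε₂₉ = ε₂₉ := rfl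

/-- `θ₁₅ᶜᶜ¹.γ = ½` (`rfl`). [cite: Balaban1987RG1, Thm 1 p.255 (bookkeeping)] -/
theorem theta13OfThm1CC1_γ : (theta13OfThm1CC1 F N ε₀ ε₂₉ B₃ B₃' a₀ a₁).γ = 1 / 2 := rfl

/-- `θ₁₅ᶜᶜ¹.s2 = sect2NumericsOfThm1C F.L` (`rfl`). [cite: Balaban1988Convergent, (2.28) p.259 (bookkeeping)] -/
theorem theta13OfThm1CC1_s2 : (theta13OfThm1CC1 F N ε₀ ε₂₉ B₃ B₃' a₀ a₁).s2 = sect2NumericsOfThm1C F.L := rfl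

/-- `θ₁₅ᶜᶜ¹.s2.cB = 6·F.L + 1` (`rfl`). [cite: Balaban1987RG1, (1.12) p.262 (bookkeeping)] -/
theorem theta13OfThm1CC1_cB : (theta13OfThm1CC1 F N ε₀ ε₂₉ B₃ B₃' a₀ a₁).s2.cB = 6 * F.L + 1 := rfl

/-- `θ₁₅ᶜᶜ¹.s2.B = 7` (`rfl`). [cite: Balaban1988Convergent, (2.38) p.261 (bookkeeping)] -/
theorem theta13OfThm1CC1_B : (theta13OfThm1CC1 F N ε₀ ε₂₉ B₃ B₃' a₀ a₁).s2.B = 7 := rfl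

/-- `θ₁₅ᶜᶜ¹.s2.C = 1` (`rfl`). [cite: Balaban1988Convergent, (2.38) p.261 (bookkeeping)] -/
theorem theta13OfThm1CC1_C : (theta13OfThm1CC1 F N ε₀ ε₂₉ B₃ B₃' a₀ a₁).s2.C = 1 := rfl

/-- `θ₁₅ᶜᶜ¹.s2.Mr = 1` (`rfl`). [cite: Balaban1988Convergent, (2.38) p.261 (bookkeeping)] -/
theorem theta13OfThm1CC1_Mr : (theta13OfThm1CC1 F N ε₀ ε₂₉ B₃ B₃' a₀ a₁).s2.Mr = 1 := rfl

/-- `θ₁₅ᶜᶜ¹.s2.cR = 1` (`rfl`). [cite: Balaban1988Convergent, (2.10) p.256 (bookkeeping)] -/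
theorem theta13OfThm1CC1_cR : (theta13OfThm1CC1 F N ε₀ ε₂₉ B₃ B₃' a₀ a₁).s2.cR = 1 := rfl

/-- `θ₁₅ᶜᶜ¹.s2.βc = ¼` (`rfl`). [cite: Balaban1988Convergent, (2.34) p.261 (bookkeeping)] -/
theorem theta13OfThm1CC1_βc : (theta13OfThm1CC1 F N ε₀ ε₂₉ B₃ B₃' a₀ a₁).s2.βc = 1 / 4 := rfl

/-- `θ₁₅ᶜᶜ¹.s2.lf.κ = 2·10⁴` (`rfl`). [cite: Balaban1987RG1, (1.18) p.263 (bookkeeping)] -/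
theorem theta13OfThm1CC1_κ : (theta13OfThm1CC1 F N ε₀ ε₂₉ B₃ B₃' a₀ a₁).s2.lf.κ = 20000 := rfl

/-- The term constants of record at `θ₁₅ᶜᶜ¹` ARE the family's with `γ = ½` (`rfl`). [cite: Balaban1988Convergent, (2.28) p.259 (bookkeeping)] -/
theorem lfOfRecord₁₂_theta13OfThm1CC1 :
    lfOfRecord₁₂ F N (theta13OfThm1CC1 F N ε₀ ε₂₉ B₃ B₃' a₀ a₁).toStage12Params = { lfConstsOfFamily with γ := 1 / 2 } := rfl

/-- `θ₁₅ᶜᶜ¹.τ9.M = 1` (`rfl`). [cite: Balaban1989LargeFieldI, (2.1) p.182 (bookkeeping)] -/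
theorem theta13OfThm1CC1_τ9_M : (theta13OfThm1CC1 F N ε₀ ε₂₉ B₃ B₃' a₀ a₁).τ9.M = 1 := rfl

/-- `θ₁₅ᶜᶜ¹.A₁ = 1` (`rfl`). [cite: Balaban1987RG1, (1.16) p.262 (bookkeeping)] -/
theorem theta13OfThm1CC1_A₁ : (theta13OfThm1CC1 F N ε₀ ε₂₉ B₃ B₃' a₀ a₁).A₁ = 1 := rfl

/-- `θ₁₅ᶜᶜ¹.Rz = RzOfRecord F N` (`rfl`). [cite: Balaban1988Convergent, (2.21) p.258 (bookkeeping)] -/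
theorem theta13OfThm1CC1_Rz : (theta13OfThm1CC1 F N ε₀ ε₂₉ B₃ B₃' a₀ a₁).Rz = RzOfRecord F N := rfl

/-- `θ₁₅ᶜᶜ¹.ℓ₆ + 1 = F.L`. [cite: Balaban1987RG1, (0.1) p.251 (bookkeeping)] -/
theorem theta13OfThm1CC1_ℓ₆_succ : (theta13OfThm1CC1 F N ε₀ ε₂₉ B₃ B₃' a₀ a₁).ℓ₆ + 1 = F.L := stage3OfFamily_ℓ₆_succ F

/-- N10's Lemma-3 level-T binder at `θ₁₅ᶜᶜ¹`: `8 ≤ θ.ℓ₆ + 1`. [cite: Balaban1987RG1, (0.1) p.251; Balaban1988RG2Cluster, (2.36) p.19] -/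
theorem eight_le_L_theta13OfThm1CC1 : 8 ≤ (theta13OfThm1CC1 F N ε₀ ε₂₉ B₃ B₃' a₀ a₁).ℓ₆ + 1 := eight_le_L_stage3OfFamily F

/-- Row N1 at `θ₁₅ᶜᶜ¹`: the (D4) `tree` numeral. [cite: Balaban1987RG1, (0.25)–(0.26) p.257] -/
theorem kp_tree_theta13OfThm1CC1 : 128 * Real.log 162 ≤ (theta13OfThm1CC1 F N ε₀ ε₂₉ B₃ B₃' a₀ a₁).s2.lf.κ := kp_tree_lfConstsOfFamily

/-- Row N1 at `θ₁₅ᶜᶜ¹`: the (D4) `large` numeral at the family's block size. [cite: Balaban1987RG1, (0.25)–(0.26) p.257; Balaban1988RG2Cluster, p.21 (after (2.39))] -/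
theorem kp_large_theta13OfThm1CC1 :
    10 * (64 * Real.log 162 + 1) ≤
      (((((theta13OfThm1CC1 F N ε₀ ε₂₉ B₃ B₃' a₀ a₁).ℓ₆ + 1 : ℕ) : ℝ)) / 2 - 1) * (theta13OfThm1CC1 F N ε₀ ε₂₉ B₃ B₃' a₀ a₁).s2.lf.κ := by
  rw [theta13OfThm1CC1_ℓ₆_succ, theta13OfThm1CC1_s2, sect2NumericsOfThm1C_lf]
  have h3 : 3 ≤ F.L := by have := F.hL11; omega
  exact kp_large_lfConstsOfFamily_of_three_le h3

/-- Row N1 at `θ₁₅ᶜᶜ¹`: N10's rate threshold. [cite: Balaban1987RG1, (1.18) p.263 (bookkeeping numeral)] -/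
theorem kp_n10_theta13OfThm1CC1 : (2 * 10 ^ 4 : ℝ) ≤ (theta13OfThm1CC1 F N ε₀ ε₂₉ B₃ B₃' a₀ a₁).s2.lf.κ := kp_n10_lfConstsOfFamily

/-- `θ₁₅ᶜᶜ¹` carries K0b's residuals of record (`⟨rfl, rfl, rfl⟩`). [cite: Balaban1988Convergent, (3.16) p.268, (2.21) p.258, (3.20) p.269 (bookkeeping)] -/
theorem hasResidualsOfRecord_theta13OfThm1CC1 : (theta13OfThm1CC1 F N ε₀ ε₂₉ B₃ B₃' a₀ a₁).HasResidualsOfRecord F N :=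
  hasResidualsOfRecord_theta13LiveOfNumerics F N (stage12NumericsOfThm1CC1 F.L ε₀ B₃ B₃' a₀ a₁) ε₂₉

/-- **… hence `ZtUnity` at `θ₁₅ᶜᶜ¹`** (row Z). [cite: Balaban1988Convergent, (3.16)–(3.20) pp.268–269] -/
theorem ztUnity_theta13OfThm1CC1 : (theta13OfThm1CC1 F N ε₀ ε₂₉ B₃ B₃' a₀ a₁).ZtUnity F N :=
  ztUnity_theta13LiveOfNumerics F N (stage12NumericsOfThm1CC1 F.L ε₀ B₃ B₃' a₀ a₁) ε₂₉

variable {ε₀ ε₂₉ B₃ B₃' a₀ a₁} in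
/-- **`θ₁₅ᶜᶜ¹` IS STAGE-13 ADMISSIBLE under the signs `0 < ε₀`, `0 < ε₂₉`, `0 ≤ B₃`, `0 ≤ B₃′`, `0 < a₀`, `0 < a₁`** (row G). [cite: Balaban1987RG1, (0.21) p.256, (1.2) p.260, (2.9) p.266; Balaban1988Convergent, (2.10) p.256; Balaban1985Variational, Thm 1 p.279 (bookkeeping witness)] -/
theorem admissible_theta13OfThm1CC1 (hε : 0 < ε₀) (hε' : 0 < ε₂₉) (hB : 0 ≤ B₃) (hB' : 0 ≤ B₃') (ha₀ : 0 < a₀) (ha₁ : 0 < a₁) :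
    (theta13OfThm1CC1 F N ε₀ ε₂₉ B₃ B₃' a₀ a₁).Admissible F N :=
  admissible_theta13LiveOfNumerics F N _ _ _ (stage12NumericsOfThm1CC1_pos hε hB hB' ha₀ ha₁) hε'

/-- **★ Row P12 at `θ₁₅ᶜᶜ¹` HYPOTHESIS-FREE** (FILE 9 v1.1 `slotsNondegenerate₁₃_theta13LiveOfNumerics_of_hasResiduals`). [cite: Balaban1988Convergent, (3.22) p.269, (3.24) p.270; Balaban1989LargeFieldI, (0.3)–(0.4) p.176] -/
theorem slotsNondegenerate₁₃_theta13OfThm1CC1 : (theta13OfThm1CC1 F N ε₀ ε₂₉ B₃ B₃' a₀ a₁).SlotsNondegenerate₁₃ F N :=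
  slotsNondegenerate₁₃_theta13LiveOfNumerics_of_hasResiduals F N (stage12NumericsOfThm1CC1 F.L ε₀ B₃ B₃' a₀ a₁) ε₂₉

end Witness

end Literature.MathematicalPhysics.QuantumFieldTheory.Balaban1983to89.Node00

end
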